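import Literature.Geometry.ComplexHyperbolic.UnitBallKCentralWallCurve            -- ★ ENGINE-T parts 1–2 + the wall curve
import Literature.NumberTheory.Rogawski1990.ArchCentralLimitCompactWallValue      -- ★ `wallNormaliser_eq_four_mul_sin_sq` (p06's `m(t) = 2 − 2cos 3t`)
import HarnessLib

/-!
# The jets at `t = 0⁺` of time-dependent sheet integrals, and the three numbers of the wall germ `ψ` (ROAD A (A3), ENGINE-T part 3)

Topic `Geometry/ComplexHyperbolic`; namespace `Literature.Geometry.ComplexHyperbolic.BallModel`.  THEOREMS ONLY (no `def`, no instance, no notation, no axiom,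
no named fact, no `sorry`).  Cell `pub/hodgecm-mathlib`, ENGINE T1 (crux H413 = `stmt-HodgeConjecture-24833`); floor-1½, count-neutral, under row (S-d) ∕ «SdArch» ED. 3 node N1
(`stub_ArchCentralLimitU21`): the `ψ`-inputs of ★ `Literature.NumberTheory.Rogawski1990.quarter_sub_eq_of_wallGerms` ((A4)-V); author F0P3a-p05 (g13), 2026-09-01.

THE MATHEMATICS.  ★ ENGINE-T (`UnitBallSheetFamilyBounds`∕`Deriv`) makes `I(t) = ∫ Λ(t, W, √(ε(t)+|W|²)) d⁴W` of class `C²` on `[0, δ]` with explicit first and second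
derivatives `I₁, I₂` (differentiation under the integral against the majorants `|W|⁻¹, |W|⁻³ ∈ L¹_loc(ℝ⁴)`).  §1 here records the ONE-SIDED JETS AT `t = 0` as
equalities of `derivWithin`∕`iteratedDerivWithin 2` on `Icc 0 δ` — the currency of (A4)-V:
  `I(0) = ∫ Λ(0, W, √(ε(0)+|W|²))`, `derivWithin I (Icc 0 δ) 0 = I₁(0)`, `iteratedDerivWithin 2 I (Icc 0 δ) 0 = I₂(0)`,
and `derivWithin I (Icc 0 δ) t = I₁(t)` on the whole of `[0, δ]`.  §2 instantiates on the WALL CURVE `k_t = ζ·(e^{it}, e^{it}, e^{−2it})` of ★ `UnitBallKCentralWallCurve`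
(`ε(t) = 2 sin(3t∕2)`, `ε(0) = 0`, `ε′(0) = 3`, `ε″(0) = 0`): with `𝓘_Θ(t) := ∫ Θ(u_t•1 + iζe^{−it∕2}•N(W, √(ε(t)+|W|²))) d⁴W`,
* `𝓘_Θ(0) = ∫ Θ(ζ•1 + iζ•N(W, |W|)) d⁴W` — a CONE integral (the sheet at `t = 0` is the null cone `Q = 0`);
* `𝓘_Θ′(0⁺) = ∫ DΛ(0, W, |W|)[(1, 0, 3∕(2|W|))] d⁴W`, `𝓘_Θ″(0⁺) = ∫ D²Λ(0,W,|W|)[(1,0,3∕(2|W|))]² + DΛ(0,W,|W|)[(0, 0, −9∕(4|W|³))] d⁴W` (`Λ` the wall-curve datum);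
* THE DICTIONARY WITH (A4)-V: p06's normaliser `m(t) = 2 − 2cos 3t` IS `‖v_t − u_t‖²`, so ★ `exists_sq_smul_orbitalIntegral_wallCurve_eq` reads
  **`m(t) • Φ_Θ(k_t) = c_μ • 𝓘_Θ(t)`** for `t ∈ (0, 2π∕3)`: the function `ψ := m·Φ_Θ(k_·)` of (A4)-V is `c_μ • 𝓘_Θ` there, and `c_μ • 𝓘_Θ` is `C²` on `[0, δ]` with the three
  numbers above (`exists_wallGerm_psi`).
HONEST LABEL: HC_CM is proved only modulo the printed citations until rung 0 closes; this file is real analysis in the ball model and pays nothing by itself.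

## References
* [Rogawski1990] J. D. Rogawski, *Automorphic Representations of Unitary Groups in Three Variables*, Ann. of Math. Stud. 123 (1990), §8.4 pp. 126–127.
* [Rudin1980] W. Rudin, *Function Theory in the Unit Ball of ℂⁿ* (1980), §1.4.
* [Goldman1999] W. M. Goldman, *Complex Hyperbolic Geometry* (1999), §3.1.
-/

noncomputable section

open MeasureTheory MeasureTheory.Measure Set Filter Topology Metric Matrix Complex
open scoped ENNReal Matrix.Norms.Operator

namespace Literature.Geometry.ComplexHyperbolic.BallModel

/-! ### §1 One-sided jets of `I(t) = ∫ Λ(t, W, √(ε(t)+|W|²)) d⁴W` at `t = 0` (generic ENGINE-T data) -/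

section EngineT

variable {G : Type*} [NormedAddCommGroup G] [NormedSpace ℝ G] {Λ : ℝ × (Fin 2 → ℂ) × ℝ → G} {S T : ℝ} {ε ε₁ ε₂ : ℝ → ℝ}

/-- **`derivWithin I (Icc 0 δ) t = I₁(t)` ON THE WHOLE OF `[0, δ]`** (`0 < δ < T`). [cite: Rogawski1990, §8.4 pp. 126–127] [cite: Rudin1980, §1.4] -/
theorem derivWithin_integral_family_eq (hΛ : ContDiff ℝ 2 Λ) (hS : ∀ (t : ℝ) (W : Fin 2 → ℂ) (r : ℝ), S ≤ r ^ 2 → Λ (t, W, r) = 0)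
    (hε : ∀ t, HasDerivAt ε (ε₁ t) t) (hε₁c : Continuous ε₁) (hε0 : ∀ t ∈ Icc (0 : ℝ) T, 0 ≤ ε t) (hεpos : ∀ t ∈ Ioo (0 : ℝ) T, 0 < ε t)
    {δ : ℝ} (hδ : 0 < δ) (hδT : δ < T) {t : ℝ} (ht : t ∈ Icc (0 : ℝ) δ) :
    derivWithin (fun t : ℝ => ∫ W : Fin 2 → ℂ, Λ (t, W, Real.sqrt (ε t + nsq W))) (Icc 0 δ) t =
      ∫ W : Fin 2 → ℂ, (fderiv ℝ Λ (t, W, Real.sqrt (ε t + nsq W))) ((1 : ℝ), (0 : Fin 2 → ℂ), ε₁ t * (2 * Real.sqrt (ε t + nsq W))⁻¹) := by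
  have hT : 0 < T := hδ.trans hδT
  have hU : UniqueDiffOn ℝ (Icc (0 : ℝ) δ) := uniqueDiffOn_Icc hδ
  rcases eq_or_lt_of_le ht.1 with h0 | hpos
  · subst h0
    exact ((hasDerivWithinAt_integral_family_zero hΛ hS hε hε₁c hε0 hεpos hT).mono fun y hy => hy.1).derivWithin (hU 0 ht)
  · exact (hasDerivAt_integral_family hΛ hS hε hε₁c hε0 hεpos ⟨hpos, lt_of_le_of_lt ht.2 hδT⟩).2.hasDerivWithinAt.derivWithin (hU t ht)

/-- **THE FIRST ONE-SIDED JET**: `derivWithin I (Icc 0 δ) 0 = I₁(0)`. [cite: Rogawski1990, §8.4 pp. 126–127] [cite: Rudin1980, §1.4] -/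
theorem derivWithin_integral_family_zero (hΛ : ContDiff ℝ 2 Λ) (hS : ∀ (t : ℝ) (W : Fin 2 → ℂ) (r : ℝ), S ≤ r ^ 2 → Λ (t, W, r) = 0)
    (hε : ∀ t, HasDerivAt ε (ε₁ t) t) (hε₁c : Continuous ε₁) (hε0 : ∀ t ∈ Icc (0 : ℝ) T, 0 ≤ ε t) (hεpos : ∀ t ∈ Ioo (0 : ℝ) T, 0 < ε t)
    {δ : ℝ} (hδ : 0 < δ) (hδT : δ < T) :
    derivWithin (fun t : ℝ => ∫ W : Fin 2 → ℂ, Λ (t, W, Real.sqrt (ε t + nsq W))) (Icc 0 δ) 0 =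
      ∫ W : Fin 2 → ℂ, (fderiv ℝ Λ (0, W, Real.sqrt (ε 0 + nsq W))) ((1 : ℝ), (0 : Fin 2 → ℂ), ε₁ 0 * (2 * Real.sqrt (ε 0 + nsq W))⁻¹) :=
  derivWithin_integral_family_eq hΛ hS hε hε₁c hε0 hεpos hδ hδT (left_mem_Icc.2 hδ.le)

/-- **THE SECOND ONE-SIDED JET**: `iteratedDerivWithin 2 I (Icc 0 δ) 0 = I₂(0)`. [cite: Rogawski1990, §8.4 pp. 126–127] [cite: Rudin1980, §1.4] -/
theorem iteratedDerivWithin_two_integral_family_zero (hΛ : ContDiff ℝ 2 Λ) (hS : ∀ (t : ℝ) (W : Fin 2 → ℂ) (r : ℝ), S ≤ r ^ 2 → Λ (t, W, r) = 0)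
    (hε : ∀ t, HasDerivAt ε (ε₁ t) t) (hε' : ∀ t, HasDerivAt ε₁ (ε₂ t) t) (hε₂c : Continuous ε₂)
    (hε0 : ∀ t ∈ Icc (0 : ℝ) T, 0 ≤ ε t) (hεpos : ∀ t ∈ Ioo (0 : ℝ) T, 0 < ε t) {δ : ℝ} (hδ : 0 < δ) (hδT : δ < T) :
    iteratedDerivWithin 2 (fun t : ℝ => ∫ W : Fin 2 → ℂ, Λ (t, W, Real.sqrt (ε t + nsq W))) (Icc 0 δ) 0 =
      ∫ W : Fin 2 → ℂ, ((fderiv ℝ (fderiv ℝ Λ) (0, W, Real.sqrt (ε 0 + nsq W)) ((1 : ℝ), (0 : Fin 2 → ℂ), ε₁ 0 * (2 * Real.sqrt (ε 0 + nsq W))⁻¹))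
          ((1 : ℝ), (0 : Fin 2 → ℂ), ε₁ 0 * (2 * Real.sqrt (ε 0 + nsq W))⁻¹) +
        (fderiv ℝ Λ (0, W, Real.sqrt (ε 0 + nsq W)))
          ((0 : ℝ), (0 : Fin 2 → ℂ), ε₂ 0 * (2 * Real.sqrt (ε 0 + nsq W))⁻¹ - ε₁ 0 ^ 2 * (4 * Real.sqrt (ε 0 + nsq W) ^ 3)⁻¹)) := by
  have hT : 0 < T := hδ.trans hδT
  have hU : UniqueDiffOn ℝ (Icc (0 : ℝ) δ) := uniqueDiffOn_Icc hδ
  have h0 : (0 : ℝ) ∈ Icc (0 : ℝ) δ := left_mem_Icc.2 hδ.le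
  have hε₁c : Continuous ε₁ := continuous_iff_continuousAt.2 fun t => (hε' t).continuousAt
  rw [iteratedDerivWithin_succ, iteratedDerivWithin_one]
  rw [derivWithin_congr (fun t ht => derivWithin_integral_family_eq hΛ hS hε hε₁c hε0 hεpos hδ hδT ht)
    (derivWithin_integral_family_eq hΛ hS hε hε₁c hε0 hεpos hδ hδT h0)]
  exact ((hasDerivWithinAt_integral_family_one hΛ hS hε hε' hε₂c hε0 hεpos hT).mono fun y hy => hy.1).derivWithin (hU 0 h0)

end EngineT

/-! ### §2 The wall curve: the cone integral at `t = 0`, the two one-sided jets, and the dictionary with (A4)-V -/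

section WallCurve

variable {G : Type*} [NormedAddCommGroup G] [NormedSpace ℝ G]

/-- `ε(0) = 0`, `ε′(0) = 3`, `ε″(0) = 0` for the wall radius `ε(t) = 2 sin(3t∕2)`. [cite: Rogawski1990, §8.4 pp. 126–127] -/
theorem wallRadius_jets_zero :
    2 * Real.sin (3 * (0 : ℝ) / 2) = 0 ∧ 3 * Real.cos (3 * (0 : ℝ) / 2) = 3 ∧ -(9 / 2) * Real.sin (3 * (0 : ℝ) / 2) = 0 := by
  simp

/-- **p06's NORMALISER IS THE SQUARED EIGENVALUE GAP**: `‖v_t − u_t‖² = 2 − 2cos 3t` on `[0, 2π∕3]`. [cite: Rogawski1990, §8.4 p. 126] -/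
theorem norm_wallCurve_sub_sq (ζ : Circle) {t : ℝ} (ht : t ∈ Icc (0 : ℝ) (2 * Real.pi / 3)) :
    ‖((ζ * Circle.exp (-2 * t) : Circle) : ℂ) - ((ζ * Circle.exp t : Circle) : ℂ)‖ ^ 2 = 2 - 2 * Real.cos (3 * t) := by
  rw [norm_wallCurve_sub ζ ht, Literature.NumberTheory.Rogawski1990.wallNormaliser_eq_four_mul_sin_sq]
  ring

/-- **THE VALUE AT `t = 0` IS A CONE INTEGRAL**: `𝓘_Θ(0) = ∫ Θ(ζ•1 + iζ•N(W, √|W|²)) d⁴W` (the sheet at `t = 0` is the null cone). [cite: Rogawski1990, §8.4 pp. 126–127] -/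
theorem wallCurve_sheetIntegral_zero (Θ : Matrix (Fin 3) (Fin 3) ℂ → G) (ζ : Circle) :
    (fun t : ℝ => ∫ W : Fin 2 → ℂ, Θ (((ζ * Circle.exp t : Circle) : ℂ) • (1 : Matrix (Fin 3) (Fin 3) ℂ) +
      (I * (ζ : ℂ) * Complex.exp (-(t / 2 : ℝ) * I)) •
        (vecMulVec ![W 0, W 1, (Real.sqrt (2 * Real.sin (3 * t / 2) + nsq W) : ℂ)] (star ![W 0, W 1, (Real.sqrt (2 * Real.sin (3 * t / 2) + nsq W) : ℂ)]) * J))) 0 =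
      ∫ W : Fin 2 → ℂ, Θ ((ζ : ℂ) • (1 : Matrix (Fin 3) (Fin 3) ℂ) +
        (I * (ζ : ℂ)) • (vecMulVec ![W 0, W 1, (Real.sqrt (nsq W) : ℂ)] (star ![W 0, W 1, (Real.sqrt (nsq W) : ℂ)]) * J)) := by
  simp

/-- **THE FIRST ONE-SIDED JET OF THE WALL-CURVE SHEET INTEGRAL** (`ε(0) = 0`, `ε′(0) = 3`): `𝓘_Θ′(0⁺) = ∫ DΛ(0, W, |W|)[(1, 0, 3∕(2|W|))] d⁴W`.
[cite: Rogawski1990, §8.4 pp. 126–127] [cite: Rudin1980, §1.4] -/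
theorem derivWithin_wallCurve_sheetIntegral_zero (Θ : Matrix (Fin 3) (Fin 3) ℂ → G) (hΘ : ContDiff ℝ 2 Θ) (hΘc : HasCompactSupport Θ) (ζ : Circle)
    {δ : ℝ} (hδ : 0 < δ) (hδ' : δ < 2 * Real.pi / 3) :
    derivWithin (fun t : ℝ => ∫ W : Fin 2 → ℂ, Θ (((ζ * Circle.exp t : Circle) : ℂ) • (1 : Matrix (Fin 3) (Fin 3) ℂ) +
      (I * (ζ : ℂ) * Complex.exp (-(t / 2 : ℝ) * I)) •
        (vecMulVec ![W 0, W 1, (Real.sqrt (2 * Real.sin (3 * t / 2) + nsq W) : ℂ)] (star ![W 0, W 1, (Real.sqrt (2 * Real.sin (3 * t / 2) + nsq W) : ℂ)]) * J))) (Icc 0 δ) 0 =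
      ∫ W : Fin 2 → ℂ, (fderiv ℝ (fun p : ℝ × (Fin 2 → ℂ) × ℝ => Θ (((ζ * Circle.exp p.1 : Circle) : ℂ) • (1 : Matrix (Fin 3) (Fin 3) ℂ) +
          (I * (ζ : ℂ) * Complex.exp (-(p.1 / 2 : ℝ) * I)) • (vecMulVec ![p.2.1 0, p.2.1 1, (p.2.2 : ℂ)] (star ![p.2.1 0, p.2.1 1, (p.2.2 : ℂ)]) * J)))
          (0, W, Real.sqrt (nsq W))) ((1 : ℝ), (0 : Fin 2 → ℂ), 3 * (2 * Real.sqrt (nsq W))⁻¹) := by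
  obtain ⟨S, hS⟩ := exists_sq_support_bound_wallCurve Θ hΘc ζ
  have hε₁c : Continuous fun t : ℝ => 3 * Real.cos (3 * t / 2) := by fun_prop
  have h := derivWithin_integral_family_zero (T := 2 * Real.pi / 3)
    (Λ := fun p : ℝ × (Fin 2 → ℂ) × ℝ => Θ (((ζ * Circle.exp p.1 : Circle) : ℂ) • (1 : Matrix (Fin 3) (Fin 3) ℂ) +
      (I * (ζ : ℂ) * Complex.exp (-(p.1 / 2 : ℝ) * I)) • (vecMulVec ![p.2.1 0, p.2.1 1, (p.2.2 : ℂ)] (star ![p.2.1 0, p.2.1 1, (p.2.2 : ℂ)]) * J)))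
    (ε := fun t : ℝ => 2 * Real.sin (3 * t / 2)) (ε₁ := fun t : ℝ => 3 * Real.cos (3 * t / 2))
    (contDiff_wallCurve_datum Θ hΘ ζ) hS hasDerivAt_wallRadius hε₁c (fun t ht => wallRadius_nonneg ht) (fun t ht => wallRadius_pos ht) hδ hδ'
  simpa using h

/-- **THE SECOND ONE-SIDED JET OF THE WALL-CURVE SHEET INTEGRAL** (`ε(0) = 0`, `ε′(0) = 3`, `ε″(0) = 0`):
`𝓘_Θ″(0⁺) = ∫ D²Λ(0, W, |W|)[(1,0,3∕(2|W|)), (1,0,3∕(2|W|))] + DΛ(0, W, |W|)[(0, 0, −9∕(4|W|³))] d⁴W`. [cite: Rogawski1990, §8.4 pp. 126–127] [cite: Rudin1980, §1.4] -/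
theorem iteratedDerivWithin_two_wallCurve_sheetIntegral_zero (Θ : Matrix (Fin 3) (Fin 3) ℂ → G) (hΘ : ContDiff ℝ 2 Θ) (hΘc : HasCompactSupport Θ) (ζ : Circle)
    {δ : ℝ} (hδ : 0 < δ) (hδ' : δ < 2 * Real.pi / 3) :
    iteratedDerivWithin 2 (fun t : ℝ => ∫ W : Fin 2 → ℂ, Θ (((ζ * Circle.exp t : Circle) : ℂ) • (1 : Matrix (Fin 3) (Fin 3) ℂ) +
      (I * (ζ : ℂ) * Complex.exp (-(t / 2 : ℝ) * I)) •
        (vecMulVec ![W 0, W 1, (Real.sqrt (2 * Real.sin (3 * t / 2) + nsq W) : ℂ)] (star ![W 0, W 1, (Real.sqrt (2 * Real.sin (3 * t / 2) + nsq W) : ℂ)]) * J))) (Icc 0 δ) 0 =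
      ∫ W : Fin 2 → ℂ,
        ((fderiv ℝ (fderiv ℝ (fun p : ℝ × (Fin 2 → ℂ) × ℝ => Θ (((ζ * Circle.exp p.1 : Circle) : ℂ) • (1 : Matrix (Fin 3) (Fin 3) ℂ) +
            (I * (ζ : ℂ) * Complex.exp (-(p.1 / 2 : ℝ) * I)) • (vecMulVec ![p.2.1 0, p.2.1 1, (p.2.2 : ℂ)] (star ![p.2.1 0, p.2.1 1, (p.2.2 : ℂ)]) * J))))
            (0, W, Real.sqrt (nsq W)) ((1 : ℝ), (0 : Fin 2 → ℂ), 3 * (2 * Real.sqrt (nsq W))⁻¹)) ((1 : ℝ), (0 : Fin 2 → ℂ), 3 * (2 * Real.sqrt (nsq W))⁻¹) +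
          (fderiv ℝ (fun p : ℝ × (Fin 2 → ℂ) × ℝ => Θ (((ζ * Circle.exp p.1 : Circle) : ℂ) • (1 : Matrix (Fin 3) (Fin 3) ℂ) +
            (I * (ζ : ℂ) * Complex.exp (-(p.1 / 2 : ℝ) * I)) • (vecMulVec ![p.2.1 0, p.2.1 1, (p.2.2 : ℂ)] (star ![p.2.1 0, p.2.1 1, (p.2.2 : ℂ)]) * J)))
            (0, W, Real.sqrt (nsq W))) ((0 : ℝ), (0 : Fin 2 → ℂ), -(9 * (4 * Real.sqrt (nsq W) ^ 3)⁻¹))) := by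
  obtain ⟨S, hS⟩ := exists_sq_support_bound_wallCurve Θ hΘc ζ
  have hε₂c : Continuous fun t : ℝ => -(9 / 2) * Real.sin (3 * t / 2) := by fun_prop
  have h := iteratedDerivWithin_two_integral_family_zero (T := 2 * Real.pi / 3)
    (Λ := fun p : ℝ × (Fin 2 → ℂ) × ℝ => Θ (((ζ * Circle.exp p.1 : Circle) : ℂ) • (1 : Matrix (Fin 3) (Fin 3) ℂ) +
      (I * (ζ : ℂ) * Complex.exp (-(p.1 / 2 : ℝ) * I)) • (vecMulVec ![p.2.1 0, p.2.1 1, (p.2.2 : ℂ)] (star ![p.2.1 0, p.2.1 1, (p.2.2 : ℂ)]) * J)))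
    (ε := fun t : ℝ => 2 * Real.sin (3 * t / 2)) (ε₁ := fun t : ℝ => 3 * Real.cos (3 * t / 2)) (ε₂ := fun t : ℝ => -(9 / 2) * Real.sin (3 * t / 2))
    (contDiff_wallCurve_datum Θ hΘ ζ) hS hasDerivAt_wallRadius hasDerivAt_wallRadius_deriv hε₂c (fun t ht => wallRadius_nonneg ht) (fun t ht => wallRadius_pos ht) hδ hδ'
  simp only [mul_zero, zero_div, Real.sin_zero, Real.cos_zero, mul_one, zero_add, zero_mul, zero_sub] at h
  rw [h]
  congr 1; ext W; congr 2
  norm_num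

/-- **THE `ψ`-PACKAGE FOR (A4)-V.**  For every Haar measure `μ` on `U(2,1)` there is `c > 0` such that for every `Θ ∈ C²_c(M₃(ℂ))` and `ζ ∈ S¹`: with
`𝓘(t) = ∫ Θ(u_t•1 + iζe^{−it∕2}•N(W, √(2 sin(3t∕2)+|W|²))) d⁴W`, (i) **`(2 − 2cos 3t) • Φ_Θ(k_t) = c • 𝓘(t)`** for `t ∈ (0, 2π∕3)` (p06's `ψ = m·Φ(k_·)` is `c • 𝓘`);
(ii) `𝓘` is `C²` on `[0, δ]` for every `0 < δ < 2π∕3`; (iii) `𝓘(0)` is the cone integral of `wallCurve_sheetIntegral_zero` and the one-sided jets are those of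
`derivWithin_wallCurve_sheetIntegral_zero` ∕ `iteratedDerivWithin_two_wallCurve_sheetIntegral_zero`. [cite: Rogawski1990, §8.4 pp. 126–127] -/
theorem exists_wallGerm_psi (μ : Measure U21) [μ.IsHaarMeasure] :
    ∃ c : ℝ, 0 < c ∧ ∀ (Θ : Matrix (Fin 3) (Fin 3) ℂ → G), ContDiff ℝ 2 Θ → HasCompactSupport Θ → ∀ (ζ : Circle),
      (∀ t ∈ Ioo (0 : ℝ) (2 * Real.pi / 3),
        (2 - 2 * Real.cos (3 * t)) •
          (∫ g, Θ (mat (g * mkU21 (Matrix.diagonal ![((ζ * Circle.exp t : Circle) : ℂ), ((ζ * Circle.exp t : Circle) : ℂ), ((ζ * Circle.exp (-2 * t) : Circle) : ℂ)])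
            (diagonal_uuv_preserves (ζ * Circle.exp t) (ζ * Circle.exp (-2 * t))) * g⁻¹)) ∂μ) =
        c • ∫ W : Fin 2 → ℂ, Θ (((ζ * Circle.exp t : Circle) : ℂ) • (1 : Matrix (Fin 3) (Fin 3) ℂ) +
          (I * (ζ : ℂ) * Complex.exp (-(t / 2 : ℝ) * I)) •
            (vecMulVec ![W 0, W 1, (Real.sqrt (2 * Real.sin (3 * t / 2) + nsq W) : ℂ)] (star ![W 0, W 1, (Real.sqrt (2 * Real.sin (3 * t / 2) + nsq W) : ℂ)]) * J))) ∧
      ∀ δ : ℝ, 0 < δ → δ < 2 * Real.pi / 3 →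
        ContDiffOn ℝ 2 (fun t : ℝ => c • ∫ W : Fin 2 → ℂ, Θ (((ζ * Circle.exp t : Circle) : ℂ) • (1 : Matrix (Fin 3) (Fin 3) ℂ) +
          (I * (ζ : ℂ) * Complex.exp (-(t / 2 : ℝ) * I)) •
            (vecMulVec ![W 0, W 1, (Real.sqrt (2 * Real.sin (3 * t / 2) + nsq W) : ℂ)] (star ![W 0, W 1, (Real.sqrt (2 * Real.sin (3 * t / 2) + nsq W) : ℂ)]) * J))) (Icc 0 δ) := by
  obtain ⟨c, hc, h⟩ := exists_sq_smul_orbitalIntegral_wallCurve_eq (G := G) μ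
  refine ⟨c, hc, fun Θ hΘ hΘc ζ => ⟨fun t ht => ?_, fun δ hδ hδ' => ?_⟩⟩
  · rw [← norm_wallCurve_sub_sq ζ ⟨ht.1.le, ht.2.le⟩]
    exact h Θ hΘ.continuous ζ t ht
  · exact contDiffOn_const.smul (contDiffOn_two_wallCurve_sheetIntegral Θ hΘ hΘc ζ hδ hδ')

end WallCurve

end Literature.Geometry.ComplexHyperbolic.BallModel

end
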